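import Mathlib
import HarnessLib

/-!
# Weierstrass corrections: the fixed-point relations behind the simultaneous interval root methods and the
# a posteriori inclusion discs of Braess–Hadeler, Smith and Gerschgorin type

Topic `Literature/Analysis/ValidatedNumerics`; namespace `Literature.Analysis.ValidatedNumerics.WeierstrassRootInclusion`.
Let `P` be a MONIC polynomial of degree `n = #s` over a field `F` and let `z : ι → F` be pairwise distinct
approximations (`Set.InjOn z s`) to its zeros. WEIERSTRASS' CORRECTION of the `i`-th approximation is
`W i = P (z i) / ∏_{j ≠ i} (z i - z j)` (`weierstrassCorr`; the Durand–Kerner step is `z i ↦ z i - W i`). This file proves,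
with Mathlib's Lagrange-interpolation vocabulary (`Lagrange.nodal`, `Lagrange.nodalWeight`, `Lagrange.interpolate`):

* the Weierstrass–Lagrange identity `P = ∏_j (X - z j) + Σ_i W i · ∏_{j ≠ i} (X - z j)` (`eq_nodal_add_sum`) and its
  divided form `P w = ∏_j (w - z j) · (1 + Σ_i W i / (w - z i))` off the nodes (`eval_eq_nodal_mul`), whence
  `Σ_i W i / (ζ - z i) = -1` at every zero `ζ` of `P` that is not a node (`sum_weierstrassCorr_div_eq_neg_one`);
* the A POSTERIORI INCLUSION DISCS over a normed field (in particular `ℂ`): every zero `ζ` of `P` satisfies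
  `‖ζ - z i‖ ≤ n‖W i‖` for some `i` (Braess–Hadeler discs, `exists_norm_sub_le_card_mul`),
  `‖ζ - (z i - W i)‖ ≤ (n - 1)‖W i‖` for some `i` (Smith's discs, `exists_norm_sub_add_le_card_sub_one_mul`), and
  `‖ζ - (z i - W i)‖ ≤ Σ_{j ≠ i} ‖W j‖` for some `i` (the Gerschgorin row discs of the matrix
  `B = diag (z) - 𝟙 · [W 1 ⋯ W n]` whose characteristic polynomial is `P`, `exists_norm_sub_add_le_sum`); set forms
  `zeros_subset_iUnion_closedBall*`. These are the error bounds a validated simultaneous root finder reports for free,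
  since the `W i` are computed anyway;
* the two FIXED-POINT RELATIONS that generate the interval (disc) simultaneous methods, for a polynomial written over
  its zeros `ζ : ι → F` as `nodal s ζ = ∏_{j ∈ s} (X - ζ j)` (multiple zeros allowed): the Weierstrass–Durand–Kerner relation
  `ζ i = w - N(w) / ∏_{j ≠ i} (w - ζ j)` for `w ≠ ζ j (j ≠ i)` (`root_eq_sub_eval_div`) and the Gargantini–Henrici
  (Börsch-Supan–Maehly–Ehrlich–Aberth) relation `ζ i = w - 1 / (N'(w)/N(w) - Σ_{j ≠ i} 1/(w - ζ j))` for `w` not a zero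
  (`root_eq_sub_inv`, from the logarithmic derivative `N'(w)/N(w) = Σ_j 1/(w - ζ j)`, `eval_derivative_nodal_div`),
  together with their INCLUSION-ISOTONE set forms (`root_mem_image_pi`, `root_mem_image_pi_inv`): if `ζ j ∈ Z j` for
  `j ≠ i` and the point `w` lies outside those sets, then `ζ i` lies in the range of the iteration map over `Π_{j ≠ i} Z j` —
  the soundness statement of one step of the interval WDK method (Alefeld–Herzberger Ch. 8 (3)) and of the
  Gargantini–Henrici disc iteration (Ch. 9 (4), Thm. 1 (a)), independent of the arithmetic used to enclose that range.

Not formalised here: the counting refinements (pairwise disjoint Braess–Hadeler or Smith discs each contain exactly one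
zero; Carstensen–Elsner optimal Gerschgorin discs, Petković 2008 Thm. 1.3/1.4), which need a continuity argument. No facts,
no axioms.

## References
* G. Alefeld, J. Herzberger, *Introduction to Interval Computations*, Academic Press 1983, Ch. 8 (p. 102, derivation of the
  total-step method (3)) and Ch. 9 ((4), Theorem 1 (a)). [cite: AlefeldHerzberger1983, Ch. 8 eq. (3); Ch. 9 eq. (4), Thm. 1(a)]
* M. Petković, *Point Estimation of Root Finding Methods*, Lecture Notes in Math. 1933, Springer 2008, §1.1 (1.59) and §1.2,
  p. 28 (Braess–Hadeler and Smith discs; the matrix `B` and its Gerschgorin discs). [cite: Petkovic2008, §1.2 p. 28]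
* D. Braess, K. P. Hadeler, Simultaneous inclusion of the zeros of a polynomial, Numer. Math. 21 (1973) 161–165.
* B. T. Smith, Error bounds for zeros of a polynomial based upon Gerschgorin's theorems, J. ACM 17 (1970) 661–674.
-/

noncomputable section

open Polynomial Finset Lagrange Metric
open scoped Finset

namespace Literature.Analysis.ValidatedNumerics.WeierstrassRootInclusion

/-! ### Weierstrass' corrections and the Weierstrass–Lagrange identity -/

section Algebra

variable {F : Type*} [Field F] {ι : Type*} [DecidableEq ι] {s : Finset ι} {z : ι → F} {P : F[X]}

/-- **Weierstrass' correction** `W i = P (z i) / ∏_{j ∈ s, j ≠ i} (z i - z j)` of the approximation `z i`; the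
Weierstrass (Durand–Kerner) step is `z i ↦ z i - W i`. [cite: Petkovic2008, §1.2 (1.59)] -/
def weierstrassCorr (P : F[X]) (s : Finset ι) (z : ι → F) (i : ι) : F :=
  P.eval (z i) / ∏ j ∈ s.erase i, (z i - z j)

/-- `W i = (nodal weight of i) · P (z i)`. [folklore] -/
private theorem weierstrassCorr_eq_nodalWeight_mul (P : F[X]) (s : Finset ι) (z : ι → F) (i : ι) :
    weierstrassCorr P s z i = nodalWeight s z i * P.eval (z i) := by
  rw [weierstrassCorr, nodalWeight_eq_eval_nodal_erase_inv, eval_nodal, div_eq_mul_inv, mul_comm]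

/-- The correction of an exact zero vanishes. [folklore] -/
private theorem weierstrassCorr_eq_zero_of_eval_eq_zero {i : ι} (h : P.eval (z i) = 0) :
    weierstrassCorr P s z i = 0 := by
  rw [weierstrassCorr, h, zero_div]

omit [DecidableEq ι] in
/-- A monic `P` of degree `#s` differs from the nodal polynomial `∏_{j ∈ s} (X - z j)` by a polynomial of degree `< #s`.
[folklore] -/
private theorem degree_sub_nodal_lt (hP : P.Monic) (hdeg : P.natDegree = #s) : (P - nodal s z).degree < #s := by
  have hP0 : P ≠ 0 := hP.ne_zero
  have hd : P.degree = (nodal s z).degree := by rw [degree_nodal, degree_eq_natDegree hP0, hdeg]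
  have hlc : P.leadingCoeff = (nodal s z).leadingCoeff := by rw [hP.leadingCoeff, nodal_monic.leadingCoeff]
  calc (P - nodal s z).degree < P.degree := degree_sub_lt hd hP0 hlc
    _ = #s := by rw [degree_eq_natDegree hP0, hdeg]

/-- `P - ∏_j (X - z j)` is the Lagrange interpolant of the values `P (z i)` at the (distinct) nodes. [folklore] -/
private theorem sub_nodal_eq_interpolate (hvs : Set.InjOn z s) (hP : P.Monic) (hdeg : P.natDegree = #s) :
    P - nodal s z = interpolate s z fun i => P.eval (z i) := by
  refine eq_interpolate_of_eval_eq _ hvs (degree_sub_nodal_lt hP hdeg) fun i hi => ?_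
  rw [eval_sub, eval_nodal_at_node hi, sub_zero]

/-- **Weierstrass–Lagrange identity**: for a monic `P` of degree `n = #s` and pairwise distinct `z i`,
`P = ∏_j (X - z j) + Σ_i W i · ∏_{j ≠ i} (X - z j)`. [cite: Petkovic2008, §1.2 p. 28] -/
theorem eq_nodal_add_sum (hvs : Set.InjOn z s) (hP : P.Monic) (hdeg : P.natDegree = #s) :
    P = nodal s z + ∑ i ∈ s, C (weierstrassCorr P s z i) * nodal (s.erase i) z := by
  have h : P - nodal s z = ∑ i ∈ s, C (weierstrassCorr P s z i) * nodal (s.erase i) z := by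
    rw [sub_nodal_eq_interpolate hvs hP hdeg, interpolate_apply]
    refine sum_congr rfl fun i hi => ?_
    rw [basis_eq_prod_sub_inv_mul_nodal_div hi, ← nodal_erase_eq_nodal_div hi, ← mul_assoc, ← C_mul,
      weierstrassCorr_eq_nodalWeight_mul, mul_comm (nodalWeight s z i)]
  rw [← h]
  ring

/-- Divided form off the nodes: `P w = ∏_j (w - z j) · (1 + Σ_i W i / (w - z i))`. [cite: Petkovic2008, §1.2 p. 28] -/
theorem eval_eq_nodal_mul (hvs : Set.InjOn z s) (hP : P.Monic) (hdeg : P.natDegree = #s) {w : F}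
    (hw : ∀ i ∈ s, w ≠ z i) :
    P.eval w = (nodal s z).eval w * (1 + ∑ i ∈ s, weierstrassCorr P s z i / (w - z i)) := by
  have h := congrArg (eval w) (sub_nodal_eq_interpolate hvs hP hdeg)
  rw [eval_sub, eval_interpolate_not_at_node _ hw] at h
  rw [mul_add, mul_one, ← sub_eq_iff_eq_add', h]
  congr 1
  refine sum_congr rfl fun i _ => ?_
  rw [weierstrassCorr_eq_nodalWeight_mul, div_eq_mul_inv]
  ring

/-- At a zero `ζ` of `P` which is not one of the nodes, `Σ_i W i / (ζ - z i) = -1`. [cite: Petkovic2008,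
§1.2 p. 28] -/
theorem sum_weierstrassCorr_div_eq_neg_one (hvs : Set.InjOn z s) (hP : P.Monic) (hdeg : P.natDegree = #s)
    {ζ : F} (hζ : P.eval ζ = 0) (hne : ∀ i ∈ s, ζ ≠ z i) :
    ∑ i ∈ s, weierstrassCorr P s z i / (ζ - z i) = -1 := by
  have h := eval_eq_nodal_mul hvs hP hdeg hne
  rw [hζ, eq_comm, mul_eq_zero] at h
  rcases h with h | h
  · exact absurd h (eval_nodal_not_at_node hne)
  · linear_combination h

/-- The set of nodes is nonempty as soon as `P` (monic of degree `#s`) has a zero off the nodes. [folklore] -/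
private theorem nonempty_of_eval_eq_zero (hvs : Set.InjOn z s) (hP : P.Monic) (hdeg : P.natDegree = #s)
    {ζ : F} (hζ : P.eval ζ = 0) (hne : ∀ i ∈ s, ζ ≠ z i) : s.Nonempty := by
  rw [nonempty_iff_ne_empty]
  rintro rfl
  have h := sum_weierstrassCorr_div_eq_neg_one hvs hP hdeg hζ hne
  rw [sum_empty] at h
  exact one_ne_zero (neg_eq_zero.mp h.symm)

/-- Rearrangement around an index `i`: at a zero `ζ` off the nodes,
`ζ - (z i - W i) = -Σ_{j ≠ i} (W j / (ζ - z j)) · (ζ - z i)`. [folklore] -/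
private theorem sub_sub_weierstrassCorr_eq (hvs : Set.InjOn z s) (hP : P.Monic) (hdeg : P.natDegree = #s)
    {ζ : F} (hζ : P.eval ζ = 0) (hne : ∀ j ∈ s, ζ ≠ z j) {i : ι} (hi : i ∈ s) :
    ζ - (z i - weierstrassCorr P s z i) =
      -∑ j ∈ s.erase i, weierstrassCorr P s z j / (ζ - z j) * (ζ - z i) := by
  have hzi : ζ - z i ≠ 0 := sub_ne_zero.mpr (hne i hi)
  have h1 : ∑ j ∈ s, weierstrassCorr P s z j / (ζ - z j) * (ζ - z i) = -(ζ - z i) := by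
    rw [← sum_mul, sum_weierstrassCorr_div_eq_neg_one hvs hP hdeg hζ hne, neg_one_mul]
  rw [← add_sum_erase s _ hi, div_mul_cancel₀ _ hzi] at h1
  linear_combination h1

end Algebra

/-! ### A posteriori inclusion discs -/

section Discs

variable {F : Type*} [NormedField F] {ι : Type*} [DecidableEq ι] {s : Finset ι} {z : ι → F} {P : F[X]}

/-- **Braess–Hadeler discs.** For a monic `P` of degree `n = #s` and pairwise distinct approximations `z i`,
every zero `ζ` of `P` satisfies `‖ζ - z i‖ ≤ n · ‖W i‖` for some `i`: the union of the discs `{z i; n|W i|}`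
contains all the zeros of `P`. [cite: Petkovic2008, §1.2 p. 28 (Braess–Hadeler 1973)] -/
theorem exists_norm_sub_le_card_mul (hvs : Set.InjOn z s) (hP : P.Monic) (hdeg : P.natDegree = #s)
    {ζ : F} (hζ : P.eval ζ = 0) :
    ∃ i ∈ s, ‖ζ - z i‖ ≤ #s * ‖weierstrassCorr P s z i‖ := by
  by_cases hnode : ∃ i ∈ s, ζ = z i
  · obtain ⟨i, hi, rfl⟩ := hnode
    exact ⟨i, hi, by simp [weierstrassCorr_eq_zero_of_eval_eq_zero hζ]⟩
  push Not at hnode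
  have hsum := sum_weierstrassCorr_div_eq_neg_one hvs hP hdeg hζ hnode
  obtain ⟨i, hi, hmax⟩ := exists_max_image s (fun j => ‖weierstrassCorr P s z j / (ζ - z j)‖)
    (nonempty_of_eval_eq_zero hvs hP hdeg hζ hnode)
  refine ⟨i, hi, ?_⟩
  have hzi : 0 < ‖ζ - z i‖ := norm_pos_iff.mpr (sub_ne_zero.mpr (hnode i hi))
  have h1 : (1 : ℝ) ≤ #s * ‖weierstrassCorr P s z i / (ζ - z i)‖ := by
    calc (1 : ℝ) = ‖∑ j ∈ s, weierstrassCorr P s z j / (ζ - z j)‖ := by rw [hsum, norm_neg, norm_one]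
      _ ≤ ∑ j ∈ s, ‖weierstrassCorr P s z j / (ζ - z j)‖ := norm_sum_le _ _
      _ ≤ ∑ j ∈ s, ‖weierstrassCorr P s z i / (ζ - z i)‖ := sum_le_sum fun j hj => hmax j hj
      _ = #s * ‖weierstrassCorr P s z i / (ζ - z i)‖ := by rw [sum_const, nsmul_eq_mul]
  rw [norm_div, ← mul_div_assoc, le_div_iff₀ hzi, one_mul] at h1
  exact h1

/-- **Smith's discs.** Every zero `ζ` of `P` satisfies `‖ζ - (z i - W i)‖ ≤ (n - 1) · ‖W i‖` for some `i`
(the Gerschgorin column discs of `B = diag (z) - 𝟙 · [W 1 ⋯ W n]`). [cite: Petkovic2008, §1.2 p. 28 (Smith 1970)] -/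
theorem exists_norm_sub_add_le_card_sub_one_mul (hvs : Set.InjOn z s) (hP : P.Monic) (hdeg : P.natDegree = #s)
    {ζ : F} (hζ : P.eval ζ = 0) :
    ∃ i ∈ s, ‖ζ - (z i - weierstrassCorr P s z i)‖ ≤ (#s - 1) * ‖weierstrassCorr P s z i‖ := by
  by_cases hnode : ∃ i ∈ s, ζ = z i
  · obtain ⟨i, hi, rfl⟩ := hnode
    exact ⟨i, hi, by simp [weierstrassCorr_eq_zero_of_eval_eq_zero hζ]⟩
  push Not at hnode
  obtain ⟨i, hi, hmax⟩ := exists_max_image s (fun j => ‖weierstrassCorr P s z j / (ζ - z j)‖)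
    (nonempty_of_eval_eq_zero hvs hP hdeg hζ hnode)
  refine ⟨i, hi, ?_⟩
  have hzi : ζ - z i ≠ 0 := sub_ne_zero.mpr (hnode i hi)
  have hWi : weierstrassCorr P s z i = weierstrassCorr P s z i / (ζ - z i) * (ζ - z i) :=
    (div_mul_cancel₀ _ hzi).symm
  rw [sub_sub_weierstrassCorr_eq hvs hP hdeg hζ hnode hi, norm_neg]
  calc ‖∑ j ∈ s.erase i, weierstrassCorr P s z j / (ζ - z j) * (ζ - z i)‖
        ≤ ∑ j ∈ s.erase i, ‖weierstrassCorr P s z j / (ζ - z j) * (ζ - z i)‖ := norm_sum_le _ _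
    _ ≤ ∑ j ∈ s.erase i, ‖weierstrassCorr P s z i / (ζ - z i)‖ * ‖ζ - z i‖ :=
        sum_le_sum fun j hj => by
          rw [norm_mul]
          exact mul_le_mul_of_nonneg_right (hmax j (mem_of_mem_erase hj)) (norm_nonneg _)
    _ = (#s - 1) * ‖weierstrassCorr P s z i‖ := by
        rw [sum_const, nsmul_eq_mul, cast_card_erase_of_mem hi, ← norm_mul, ← hWi]

/-- **Gerschgorin row discs of `B`.** Every zero `ζ` of `P` satisfies `‖ζ - (z i - W i)‖ ≤ Σ_{j ≠ i} ‖W j‖` for some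
`i` (namely the index of a nearest approximation). [cite: Petkovic2008, §1.2 p. 28 (Gerschgorin's theorem
applied to B)] -/
theorem exists_norm_sub_add_le_sum (hvs : Set.InjOn z s) (hP : P.Monic) (hdeg : P.natDegree = #s)
    {ζ : F} (hζ : P.eval ζ = 0) :
    ∃ i ∈ s, ‖ζ - (z i - weierstrassCorr P s z i)‖ ≤ ∑ j ∈ s.erase i, ‖weierstrassCorr P s z j‖ := by
  by_cases hnode : ∃ i ∈ s, ζ = z i
  · obtain ⟨i, hi, rfl⟩ := hnode
    refine ⟨i, hi, ?_⟩
    rw [weierstrassCorr_eq_zero_of_eval_eq_zero hζ, sub_zero, sub_self, norm_zero]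
    exact sum_nonneg fun j _ => norm_nonneg _
  push Not at hnode
  obtain ⟨i, hi, hmin⟩ := exists_min_image s (fun j => ‖ζ - z j‖)
    (nonempty_of_eval_eq_zero hvs hP hdeg hζ hnode)
  refine ⟨i, hi, ?_⟩
  rw [sub_sub_weierstrassCorr_eq hvs hP hdeg hζ hnode hi, norm_neg]
  calc ‖∑ j ∈ s.erase i, weierstrassCorr P s z j / (ζ - z j) * (ζ - z i)‖
        ≤ ∑ j ∈ s.erase i, ‖weierstrassCorr P s z j / (ζ - z j) * (ζ - z i)‖ := norm_sum_le _ _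
    _ ≤ ∑ j ∈ s.erase i, ‖weierstrassCorr P s z j‖ :=
        sum_le_sum fun j hj => by
          have hzj : 0 < ‖ζ - z j‖ := norm_pos_iff.mpr (sub_ne_zero.mpr (hnode j (mem_of_mem_erase hj)))
          rw [norm_mul, norm_div, div_mul_eq_mul_div, div_le_iff₀ hzj]
          exact mul_le_mul_of_nonneg_left (hmin j (mem_of_mem_erase hj)) (norm_nonneg _)

/-- Set form of the Braess–Hadeler discs: the zero set of `P` is covered by `⋃_i closedBall (z i) (n‖W i‖)`.
[cite: Petkovic2008, §1.2 p. 28 (Braess–Hadeler 1973)] -/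
theorem zeros_subset_iUnion_closedBall (hvs : Set.InjOn z s) (hP : P.Monic) (hdeg : P.natDegree = #s) :
    {ζ | P.eval ζ = 0} ⊆ ⋃ i ∈ s, closedBall (z i) (#s * ‖weierstrassCorr P s z i‖) := by
  intro ζ hζ
  obtain ⟨i, hi, h⟩ := exists_norm_sub_le_card_mul hvs hP hdeg hζ
  exact Set.mem_iUnion₂.mpr ⟨i, hi, mem_closedBall.mpr (by rwa [dist_eq_norm])⟩

/-- Set form of Smith's discs: the zero set of `P` is covered by `⋃_i closedBall (z i - W i) ((n - 1)‖W i‖)`.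
[cite: Petkovic2008, §1.2 p. 28 (Smith 1970)] -/
theorem zeros_subset_iUnion_closedBall_smith (hvs : Set.InjOn z s) (hP : P.Monic) (hdeg : P.natDegree = #s) :
    {ζ | P.eval ζ = 0} ⊆
      ⋃ i ∈ s, closedBall (z i - weierstrassCorr P s z i) ((#s - 1) * ‖weierstrassCorr P s z i‖) := by
  intro ζ hζ
  obtain ⟨i, hi, h⟩ := exists_norm_sub_add_le_card_sub_one_mul hvs hP hdeg hζ
  exact Set.mem_iUnion₂.mpr ⟨i, hi, mem_closedBall.mpr (by rwa [dist_eq_norm])⟩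

/-- Set form of the Gerschgorin row discs: the zero set of `P` is covered by `⋃_i closedBall (z i - W i) (Σ_{j ≠ i} ‖W j‖)`.
[cite: Petkovic2008, §1.2 p. 28 (Gerschgorin's theorem applied to B)] -/
theorem zeros_subset_iUnion_closedBall_row (hvs : Set.InjOn z s) (hP : P.Monic) (hdeg : P.natDegree = #s) :
    {ζ | P.eval ζ = 0} ⊆
      ⋃ i ∈ s, closedBall (z i - weierstrassCorr P s z i) (∑ j ∈ s.erase i, ‖weierstrassCorr P s z j‖) := by
  intro ζ hζ
  obtain ⟨i, hi, h⟩ := exists_norm_sub_add_le_sum hvs hP hdeg hζ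
  exact Set.mem_iUnion₂.mpr ⟨i, hi, mem_closedBall.mpr (by rwa [dist_eq_norm])⟩

/-- Smith's disc `{z i - W i; (n-1)|W i|}` lies inside the Braess–Hadeler disc `{z i; n|W i|}`.
[cite: Petkovic2008, §1.2 p. 28] -/
theorem closedBall_smith_subset (i : ι) :
    closedBall (z i - weierstrassCorr P s z i) ((#s - 1) * ‖weierstrassCorr P s z i‖) ⊆
      closedBall (z i) (#s * ‖weierstrassCorr P s z i‖) := by
  refine closedBall_subset_closedBall' ?_
  rw [dist_eq_norm, sub_sub_cancel_left, norm_neg]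
  ring_nf
  rfl

end Discs

/-! ### The fixed-point relations of the simultaneous interval methods -/

section FixedPoint

variable {F : Type*} [Field F] {ι : Type*} [DecidableEq ι] {s : Finset ι}

/-- **Weierstrass–Durand–Kerner fixed-point relation.** If `N = ∏_{j ∈ s} (X - ζ j)` (zeros listed with multiplicity)
and `w ≠ ζ j` for all `j ≠ i`, then `ζ i = w - N(w) / ∏_{j ≠ i} (w - ζ j)`.
[cite: AlefeldHerzberger1983, Ch. 8 p. 102 (derivation of (3))] -/
theorem root_eq_sub_eval_div (ζ : ι → F) {i : ι} (hi : i ∈ s) {w : F} (hw : ∀ j ∈ s, j ≠ i → w ≠ ζ j) :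
    ζ i = w - (nodal s ζ).eval w / ∏ j ∈ s.erase i, (w - ζ j) := by
  have hprod : ∏ j ∈ s.erase i, (w - ζ j) ≠ 0 :=
    prod_ne_zero_iff.mpr fun j hj => sub_ne_zero.mpr (hw j (mem_of_mem_erase hj) (ne_of_mem_erase hj))
  rw [eval_nodal, ← mul_prod_erase s _ hi, mul_div_assoc, div_self hprod, mul_one, sub_sub_cancel]

/-- The same relation for `P = C a · ∏_j (X - ζ j)` with leading coefficient `a ≠ 0`:
`ζ i = w - P(w) / (a · ∏_{j ≠ i} (w - ζ j))`. [cite: Petkovic2008, §1.1 (1.59)] -/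
theorem root_eq_sub_eval_div_of_eq_C_mul {P : F[X]} {a : F} (ha : a ≠ 0) (ζ : ι → F) (hP : P = C a * nodal s ζ)
    {i : ι} (hi : i ∈ s) {w : F} (hw : ∀ j ∈ s, j ≠ i → w ≠ ζ j) :
    ζ i = w - P.eval w / (a * ∏ j ∈ s.erase i, (w - ζ j)) := by
  rw [hP, eval_mul, eval_C, mul_div_mul_left _ _ ha]
  exact root_eq_sub_eval_div ζ hi hw

/-- **Inclusion-isotone form of the WDK relation** (soundness of one step of the interval Weierstrass method): if
`ζ j ∈ Z j` for `j ≠ i` and the point `w` avoids those sets, then `ζ i` lies in the range of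
`y ↦ w - N(w) / ∏_{j ≠ i} (w - y j)` over `Π_{j ≠ i} Z j` — hence in any enclosure of that range (interval, disc,
rectangle arithmetic). [cite: AlefeldHerzberger1983, Ch. 8 eq. (3)] -/
theorem root_mem_image_pi (ζ : ι → F) {i : ι} (hi : i ∈ s) {w : F} (Z : ι → Set F)
    (hZ : ∀ j ∈ s, j ≠ i → ζ j ∈ Z j) (hw : ∀ j ∈ s, j ≠ i → w ∉ Z j) :
    ζ i ∈ (fun y : ι → F => w - (nodal s ζ).eval w / ∏ j ∈ s.erase i, (w - y j)) '' Set.pi ↑(s.erase i) Z := by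
  refine ⟨ζ, Set.mem_pi.mpr fun j hj => ?_, (root_eq_sub_eval_div ζ hi fun j hj hji h => ?_).symm⟩
  · exact hZ j (mem_of_mem_erase (mem_coe.mp hj)) (ne_of_mem_erase (mem_coe.mp hj))
  · exact hw j hj hji (by rw [h]; exact hZ j hj hji)

/-- **Logarithmic derivative**: `N'(w) / N(w) = Σ_j 1 / (w - ζ j)` for `N = ∏_j (X - ζ j)` and `w` not a zero.
[cite: Petkovic2008, §1.1 (1.52)] -/
theorem eval_derivative_nodal_div (ζ : ι → F) {w : F} (hw : ∀ j ∈ s, w ≠ ζ j) :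
    (derivative (nodal s ζ)).eval w / (nodal s ζ).eval w = ∑ j ∈ s, (w - ζ j)⁻¹ := by
  rw [derivative_nodal, eval_finsetSum, sum_div]
  refine sum_congr rfl fun j hj => ?_
  have hwj : w - ζ j ≠ 0 := sub_ne_zero.mpr (hw j hj)
  have hNj : (nodal (s.erase j) ζ).eval w ≠ 0 := eval_nodal_not_at_node fun k hk => hw k (mem_of_mem_erase hk)
  rw [nodal_eq_mul_nodal_erase hj, eval_mul, eval_sub, eval_X, eval_C, div_mul_cancel_right₀ hNj]

/-- **Gargantini–Henrici (Börsch-Supan–Maehly–Ehrlich–Aberth) fixed-point relation**: for `w` not a zero of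
`N = ∏_j (X - ζ j)`, `ζ i = w - 1 / (N'(w)/N(w) - Σ_{j ≠ i} 1/(w - ζ j))`.
[cite: AlefeldHerzberger1983, Ch. 9 eq. (4), Thm. 1(a)] -/
theorem root_eq_sub_inv (ζ : ι → F) {i : ι} (hi : i ∈ s) {w : F} (hw : ∀ j ∈ s, w ≠ ζ j) :
    ζ i = w - ((derivative (nodal s ζ)).eval w / (nodal s ζ).eval w - ∑ j ∈ s.erase i, (w - ζ j)⁻¹)⁻¹ := by
  rw [eval_derivative_nodal_div ζ hw, ← add_sum_erase s _ hi, add_sub_cancel_right, inv_inv, sub_sub_cancel]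

/-- The same relation for `P = C a · ∏_j (X - ζ j)`, `a ≠ 0` (the quotient `P'/P` does not see `a`).
[cite: AlefeldHerzberger1983, Ch. 9 eq. (4)] -/
theorem root_eq_sub_inv_of_eq_C_mul {P : F[X]} {a : F} (ha : a ≠ 0) (ζ : ι → F) (hP : P = C a * nodal s ζ)
    {i : ι} (hi : i ∈ s) {w : F} (hw : ∀ j ∈ s, w ≠ ζ j) :
    ζ i = w - ((derivative P).eval w / P.eval w - ∑ j ∈ s.erase i, (w - ζ j)⁻¹)⁻¹ := by
  rw [hP, derivative_C_mul, eval_mul, eval_mul, eval_C, mul_div_mul_left _ _ ha]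
  exact root_eq_sub_inv ζ hi hw

/-- **Inclusion-isotone form of the Gargantini–Henrici relation** (soundness of one step of the disc iteration,
Alefeld–Herzberger Ch. 9 Thm. 1 (a)): if `ζ j ∈ Z j` for `j ≠ i`, `w` avoids those sets and `w ≠ ζ i`, then `ζ i` lies in
the range of `y ↦ w - 1/(N'(w)/N(w) - Σ_{j ≠ i} 1/(w - y j))` over `Π_{j ≠ i} Z j`.
[cite: AlefeldHerzberger1983, Ch. 9 eq. (4), Thm. 1(a)] -/
theorem root_mem_image_pi_inv (ζ : ι → F) {i : ι} (hi : i ∈ s) {w : F} (Z : ι → Set F)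
    (hZ : ∀ j ∈ s, j ≠ i → ζ j ∈ Z j) (hw : ∀ j ∈ s, j ≠ i → w ∉ Z j) (hwi : w ≠ ζ i) :
    ζ i ∈ (fun y : ι → F =>
      w - ((derivative (nodal s ζ)).eval w / (nodal s ζ).eval w - ∑ j ∈ s.erase i, (w - y j)⁻¹)⁻¹) ''
        Set.pi ↑(s.erase i) Z := by
  refine ⟨ζ, Set.mem_pi.mpr fun j hj => ?_, (root_eq_sub_inv ζ hi fun j hj h => ?_).symm⟩
  · exact hZ j (mem_of_mem_erase (mem_coe.mp hj)) (ne_of_mem_erase (mem_coe.mp hj))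
  · by_cases hji : j = i
    · exact hwi (hji ▸ h)
    · exact hw j hj hji (by rw [h]; exact hZ j hj hji)

end FixedPoint

end Literature.Analysis.ValidatedNumerics.WeierstrassRootInclusion

end
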